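import Mathlib

/-!
# SigmaRowSpec — the linear-algebra heart of ROW Σ-H (hsemireg-c4-1 g5, memo `C4-EXT2-COUNT-c4-1-g5.md` §5 ∕ §10 (F4) ∕ §12.2)

Evidence-only crux workfile on `stmt-HodgeConjecture-18881` (D-0145 token: line stmt-HodgeConjecture-18881
Cruxes/BlochSeedDiscOne/Lines/birth.lean 814a6a70c14e831a stub_rung_pad4_seedAt (helper)).  An inequality of dimensions ≠ a
sheaf ≠ semiregular ≠ a SEED.  NOTHING here is proved toward HC ∕ HC_CM ∕ HC_AV ∕ №4 ∕ 26512 ∕ 18881 ∕ H2.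

WHAT IS TYPED (kernel; `import Mathlib` only — `imInKer` is re-declared verbatim from strengthen g6's `StrengthenEinfRow`
(`EinfRow.imInKer`) so that this file does not wait on that module's farm build; the two definitions are syntactically identical).  For a three-term complex of
finite-dimensional vector spaces `U →f V →g W` (`g ∘ f = 0`) with middle homology `H = ker g ⧸ im f`, a subspace `I ≤ V`
("a set of E₁-blocks"), a subspace `N ≤ W` containing `g(I)` ("the blocks N(I) reached by the live arrows"), and an
endomorphism `p` of `V` fixing `I` pointwise ("projection onto the I-blocks along the others"):

  `sigmaH_floor :  dim I ≤ dim H + dim N + rank (p ∘ f)`,   i.e.   `dim H ≥ [dim I − dim N(I)] − rank(P_I ∘ d_in)`  — this is (F4).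

With `I = V`, `N = W`, `p = id` it is strengthen's `middle_homology_floor` (ROW Σ-K per multidegree); the two max-flow ∕ König
steps of the machine row (`dim N(I*) = minimum over I` and `rank(P_I d_in) ≤ min vertex cover`) and the identification of
U, V, W with `H²(Hom(𝓝,𝓟))[k]`, `H²(End 𝓟 ⊕ End 𝓝)[k]`, `H²(Hom(𝓟,𝓝))[k]` are NOT typed here (machine: `hallrank.py`,
×3 codes; pen: (F1)–(F3)).  Section `digits` re-checks the closed arithmetic of the digits of record.
-/

set_option linter.dupNamespace false
set_option autoImplicit false

namespace Summit.HodgeConjecture.HodgeConjecture.Cruxes.BlochSeedDiscOne.SigmaRow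

open Module

section floor
variable {K : Type*} [Field K] {U V W : Type*}
  [AddCommGroup U] [Module K U] [FiniteDimensional K U]
  [AddCommGroup V] [Module K V] [FiniteDimensional K V]
  [AddCommGroup W] [Module K W] [FiniteDimensional K W]

/-- The image of `f` inside `ker g`, for a complex `U →f V →g W` (verbatim `EinfRow.imInKer` of `StrengthenEinfRow`). -/
def imInKer (f : U →ₗ[K] V) (g : V →ₗ[K] W) (hfg : ∀ u, g (f u) = 0) : Submodule K (LinearMap.ker g) :=
  LinearMap.range (LinearMap.codRestrict (LinearMap.ker g) f (fun u => by simpa [LinearMap.mem_ker] using hfg u))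

/-- KERNEL-DEFICIENCY STEP: if `g` maps `I` into `N` then `dim (ker g ⊓ I) ≥ dim I − dim N`
(stated on the restriction `gI : I → N`: `dim I ≤ dim ker gI + dim N`). -/
theorem ker_restrict_floor (g : V →ₗ[K] W) (I : Submodule K V) (N : Submodule K W) (hIN : ∀ v ∈ I, g v ∈ N) :
    finrank K I ≤ finrank K (LinearMap.ker (LinearMap.codRestrict N (g ∘ₗ I.subtype) (fun v => hIN v v.2)))
      + finrank K N := by
  set gI := LinearMap.codRestrict N (g ∘ₗ I.subtype) (fun v => hIN v v.2)
  have h1 : finrank K (LinearMap.range gI) + finrank K (LinearMap.ker gI) = finrank K I :=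
    LinearMap.finrank_range_add_finrank_ker gI
  have h2 : finrank K (LinearMap.range gI) ≤ finrank K N := Submodule.finrank_le _
  omega

/-- ROW Σ-H FLOOR (F4): for a complex `U →f V →g W`, a subspace `I ≤ V` with `g(I) ≤ N`, and `p : V → V` fixing `I` pointwise,
`dim I ≤ dim (ker g ⧸ im f) + dim N + rank (p ∘ f)`. -/
theorem sigmaH_floor (f : U →ₗ[K] V) (g : V →ₗ[K] W) (hfg : ∀ u, g (f u) = 0)
    (I : Submodule K V) (N : Submodule K W) (hIN : ∀ v ∈ I, g v ∈ N)
    (p : V →ₗ[K] V) (hp : ∀ v ∈ I, p v = v) :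
    finrank K I ≤ finrank K (LinearMap.ker g ⧸ imInKer f g hfg) + finrank K N
      + finrank K (LinearMap.range (p ∘ₗ f)) := by
  -- the restriction gI : I → N and its kernel
  set gI := LinearMap.codRestrict N (g ∘ₗ I.subtype) (fun v => hIN v v.2) with hgI
  have hA : finrank K I ≤ finrank K (LinearMap.ker gI) + finrank K N := ker_restrict_floor g I N hIN
  -- elements of ker gI are elements of ker g
  have hker : ∀ v : LinearMap.ker gI, g ((v : I) : V) = 0 := by
    intro v
    have hv : gI (v : I) = 0 := LinearMap.mem_ker.mp v.2
    exact congrArg Subtype.val hv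
  let toKer : LinearMap.ker gI →ₗ[K] LinearMap.ker g :=
    { toFun := fun v => ⟨((v : I) : V), by rw [LinearMap.mem_ker]; exact hker v⟩
      map_add' := by intro a b; ext; simp
      map_smul' := by intro c a; ext; simp }
  have toKer_val : ∀ v : LinearMap.ker gI, ((toKer v : LinearMap.ker g) : V) = ((v : I) : V) := fun v => rfl
  -- ψ : ker gI → H = ker g ⧸ im f
  let ψ : LinearMap.ker gI →ₗ[K] (LinearMap.ker g ⧸ imInKer f g hfg) := (imInKer f g hfg).mkQ ∘ₗ toKer
  have hB : finrank K (LinearMap.range ψ) + finrank K (LinearMap.ker ψ) = finrank K (LinearMap.ker gI) :=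
    LinearMap.finrank_range_add_finrank_ker ψ
  have hC : finrank K (LinearMap.range ψ) ≤ finrank K (LinearMap.ker g ⧸ imInKer f g hfg) := Submodule.finrank_le _
  -- ker ψ embeds into range (p ∘ f): an element of I ∩ ker g that is a boundary f u equals p (f u)
  have hmem : ∀ v : LinearMap.ker ψ, (((v : LinearMap.ker gI) : I) : V) ∈ LinearMap.range (p ∘ₗ f) := by
    intro v
    have hv : ψ (v : LinearMap.ker gI) = 0 := LinearMap.mem_ker.mp v.2
    have hv' : toKer (v : LinearMap.ker gI) ∈ imInKer f g hfg := (Submodule.Quotient.mk_eq_zero _).mp hv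
    obtain ⟨u, hu⟩ := hv'
    have hu' : f u = (((v : LinearMap.ker gI) : I) : V) := congrArg Subtype.val hu
    refine ⟨u, ?_⟩
    rw [LinearMap.comp_apply, hu', hp _ ((v : LinearMap.ker gI) : I).2]
  let j : LinearMap.ker ψ →ₗ[K] LinearMap.range (p ∘ₗ f) :=
    { toFun := fun v => ⟨(((v : LinearMap.ker gI) : I) : V), hmem v⟩
      map_add' := by intro a b; ext; simp
      map_smul' := by intro c a; ext; simp }
  have hj : Function.Injective j := by
    intro a b hab
    have h := congrArg Subtype.val hab
    apply Subtype.ext; apply Subtype.ext; apply Subtype.ext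
    exact h
  have hD : finrank K (LinearMap.ker ψ) ≤ finrank K (LinearMap.range (p ∘ₗ f)) :=
    LinearMap.finrank_le_finrank_of_injective hj
  omega

/-- The `I = V` specialisation is strengthen's whole-row floor (ROW Σ-K per multidegree): `dim V ≤ dim H + dim W + rank f`
(and `rank f ≤ dim U`). -/
theorem sigmaK_floor (f : U →ₗ[K] V) (g : V →ₗ[K] W) (hfg : ∀ u, g (f u) = 0) :
    finrank K V ≤ finrank K (LinearMap.ker g ⧸ imInKer f g hfg) + finrank K W + finrank K (LinearMap.range f) := by
  have h := sigmaH_floor f g hfg ⊤ ⊤ (fun v _ => Submodule.mem_top) LinearMap.id (fun v _ => rfl)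
  have h1 : finrank K (⊤ : Submodule K V) = finrank K V := finrank_top K V
  have h2 : finrank K (⊤ : Submodule K W) = finrank K W := finrank_top K W
  have h3 : (LinearMap.id ∘ₗ f : U →ₗ[K] V) = f := LinearMap.id_comp f
  rw [h1, h2, h3] at h
  exact h

end floor

section digits
/-! ## Closed arithmetic of the Σ-H ∕ Σ-K digits of record (machine digits `data/hall-table-g5.txt`, ×3 codes) and of the budgets of §12.3 -/

/-- a1a8405da9ba0240 (TW32b-p32-sharp): per mixed k, deficiency `w(I*) − w(N(I*)) = 10 720 − 5 008 = 5 712`, in-image cap 2 496 ⇒ 3 216;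
per pure k `144 − 36 − 36 = 72`; Σ-H = 6·3 216 + 4·72 = 19 584 > 5 572. -/
theorem a1a8405d_sigmaH : (10720 : ℤ) - 5008 - 2496 = 3216 ∧ (144 : ℤ) - 36 - 36 = 72 ∧ (6 * 3216 + 4 * 72 : ℤ) = 19584
    ∧ (5572 : ℤ) < 19584 := by norm_num

/-- a009d00f97400f4e ≡ 4545dca3500d9a20 ≡ d3cd3db75c00a9ea (τ room): per mixed k `19 936 − 11 152 − 2 496 = 6 288`, per pure k `984 − 676 − 36 = 272`;
Σ-H = 6·6 288 + 4·272 = 38 816; Σ-K = 6·1 120 + 4·256 = 7 744 (mixed: 24 544 − 20 928 − 2 496; pure: 992 − 688 − 48). -/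
theorem tauRoom_sigmaH : (19936 : ℤ) - 11152 - 2496 = 6288 ∧ (984 : ℤ) - 676 - 36 = 272 ∧ (6 * 6288 + 4 * 272 : ℤ) = 38816
    ∧ (24544 : ℤ) - 20928 - 2496 = 1120 ∧ (992 : ℤ) - 688 - 48 = 256 ∧ (6 * 1120 + 4 * 256 : ℤ) = 7744
    ∧ (5572 : ℤ) < 7744 ∧ (7744 : ℤ) ≤ 38816 := by norm_num

/-- RB16-plain c4c48e1eefdfc450 (nearest the door): per mixed k `62 400 − 32 560 − 28 944 = 896` (I* = all of V; minVC_out = 32 560, in-cap 28 944),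
per pure k 176; Σ-H = 6·896 + 4·176 = 6 080 > 5 572, margin 508 (< 6·85). -/
theorem rb16_sigmaH : (62400 : ℤ) - 32560 - 28944 = 896 ∧ (6 * 896 + 4 * 176 : ℤ) = 6080 ∧ (6080 : ℤ) - 5572 = 508
    ∧ (508 : ℤ) < 6 * 85 ∧ (6 * 84 : ℤ) ≤ 508 := by norm_num

/-- BUDGETS of COROLLARY Σ-FLOOR (§12.3): under (A3) `24·S2 ≤ 5 572 ⇔ S2 ≤ 232`; under (A4) `28·S2 ≤ 5 572 ⇔ S2 ≤ 199`, with `28·199 = 5 572` exactly. -/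
theorem sigmaFloor_budgets : (∀ s : ℕ, 24 * s ≤ 5572 ↔ s ≤ 232) ∧ (∀ s : ℕ, 28 * s ≤ 5572 ↔ s ≤ 199) ∧ 28 * 199 = 5572 := by
  refine ⟨fun s => ?_, fun s => ?_, by norm_num⟩ <;> omega

end digits

end Summit.HodgeConjecture.HodgeConjecture.Cruxes.BlochSeedDiscOne.SigmaRow
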